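import Summits.AtomisticToContinuum.Crystallization.Theorems.PalmUnimodularRigidityMinimiserShellsBoundaryShellAux

/-!
# The boundary lemma (stub `stub_boundaryShell`, line `elastic-coarse-to-fine` r5) of crux `MinimiserShells`

Crux item stmt-AtomisticToContinuum-9225, route `PalmUnimodularRigidity`, crux decl
`Summit.AtomisticToContinuum.Crystallization.Theses.PalmUnimodularRigidity.MinimiserShells`; skeleton r5
(`Cruxes/MinimiserShells/Lines/elastic_coarse_to_fine.lean`, lead `…-c15`).  Helpers: `…BoundaryShellAux.lean`.

**Theorem (`stub_boundaryShell`, pointwise, purely geometric — no energy).**  Grant the covering property of the two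
kissing patterns (stub `stub_patternCovering`: every vector is within `45°` of a point of the rotated FCC and of the
rotated HCP pattern).  Let `S ∋ 0` be `δ`-separated (`δ > 0`).  If the root shell of `count|S` passes the LOOSENED test
`LooseGoodShell (1/(n+10))` for every `n : ℕ` (tolerance `a/100 + θ`, radius `(5/4 − θ)·a`, `θ = 1/(n+10) → 0`) and the
shell of EVERY atom `y ∈ S` (read in `count|(S − y)`) passes the `1/100`-loosened test, then the root shell is good in
the crux's EXACT sense (`GoodShell`: some `a ∈ [9/10, 1]` at which the atoms `w ≠ 0` of the CLOSED ball `‖w‖ ≤ 5a/4`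
are twelve and `a/100`-matched, after a linear isometry, to the `a`-scaled FCC or HCP kissing pattern).

Proof.
1. DISCRETISATION (`exists_data_of_looseGoodShell`).  At level `n` the loosened test provides a scale
   `aₙ ∈ [9/10,1]`, a pattern `cₙ ∈ {fcc, hcp}`, a linear isometry `Lₙ` and an injective 12-tuple `tₙ` of atoms
   exhausting the atoms of `‖w‖ ≤ (5/4 − θₙ)aₙ`, with `dist (tₙ i) (Lₙ (aₙ • q i)) ≤ aₙ/100 + θₙ` (`q` a fixed
   enumeration of the pattern).  The tuples take values in the finite set `S ∩ B̄(0, 5/4)`, so ONE pair `(c, t)` occurs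
   for infinitely many `n` (pigeonhole, `Finite.exists_infinite_fiber`).
2. COMPACTNESS (`BoundaryShell.exists_limit_param`).  For those data the admissible parameters `(a, L)` at level `n`
   form a decreasing sequence of closed subsets meeting the compact `[9/10,1] × Iso`; Cantor's intersection theorem gives
   `(a, L)` with `dist (t i) (L (a • q i)) ≤ a/100` for all `i` and `‖w‖ ≥ 5a/4` for every other nonzero atom `w` of the
   window.
3. EXCLUSION OF THE SPHERE (`BoundaryShell.no_sphere_atom`).  An atom `k` with `‖k‖ = 5a/4` exactly would, by the
   covering property, be within `0.91a` of some `t i`; but `−t i` and `k − t i` are both atoms of the `1/100`-loosely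
   good shell of `y = t i`, forcing `‖k − t i‖ ≥ 0.948a` — contradiction.
4. Hence the atoms of the closed ball `‖w‖ ≤ 5a/4` are exactly the `t i`, matched within `a/100`
   (`BoundaryShell.shell_of_limit_data`): `GoodShell`.
-/

noncomputable section

open MeasureTheory Filter Topology
open scoped ENNReal BigOperators Classical

namespace Summit.AtomisticToContinuum.Crystallization.Theorems.PalmUnimodularRigidityMinimiserShells.BoundaryShell

open Literature.Probability.Process (IsRootedHardCore count_restrict_singleton_ne_zero_iff)
open Literature.MathematicalPhysics.StatisticalMechanics (UniformlyDiscrete)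
open Literature.Geometry.DiscreteGeometry (ShellCloseTo EtaMatched fccKissingPattern hcpKissingPattern
  card_fccKissingPattern card_hcpKissingPattern norm_eq_one_of_mem_fccKissingPattern norm_eq_one_of_mem_hcpKissingPattern)
open Summit.AtomisticToContinuum.Crystallization.Theorems.MinimiserShells.Negative.LoadBearing (GoodShell)
open Summit.AtomisticToContinuum.Crystallization.Theorems.MinimiserShells.Negative.Rootedness (E3)
open Summit.AtomisticToContinuum.Crystallization.Theorems.PalmUnimodularRigidityMinimiserShells.Residual (LooseGoodShell)

/-! ## Discretisation of one loosened test -/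

/-- **One loosened test, discretised.**  If the root shell of `count|S` is `θ`-loosely good (`0 ≤ θ ≤ 1/10`), then for
one of the two patterns (`c = true`: FCC, enumerated by `qf`; `c = false`: HCP, enumerated by `qh`) there are a scale
`a ∈ [9/10, 1]`, an isometry `L` and an injective 12-tuple `t` of nonzero atoms, with values in the finite window `F`
(the atoms of norm `≤ 5/4`), exhausting the atoms `w ≠ 0` of `‖w‖ ≤ (5/4 − θ)·a` and matched within `a/100 + θ`. -/
theorem exists_data_of_looseGoodShell {S : Set E3} {F : Finset E3} (hF : ∀ w : E3, w ∈ F ↔ w ∈ S ∧ ‖w‖ ≤ 5 / 4)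
    {qf qh : Fin 12 → E3} (hqf : Function.Injective qf) (hqfP : ∀ i, qf i ∈ fccKissingPattern)
    (hPqf : ∀ p ∈ fccKissingPattern, ∃ i, qf i = p) (hqh : Function.Injective qh)
    (hqhP : ∀ i, qh i ∈ hcpKissingPattern) (hPqh : ∀ p ∈ hcpKissingPattern, ∃ i, qh i = p)
    {θ : ℝ} (hθ0 : 0 ≤ θ) (h : LooseGoodShell θ ((Measure.count : Measure E3).restrict S)) :
    ∃ a : ℝ, 9 / 10 ≤ a ∧ a ≤ 1 ∧ ∃ c : Bool, ∃ L : E3 →L[ℝ] E3, (∀ v, ‖L v‖ = ‖v‖) ∧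
      ∃ t : Fin 12 → ↥F, Function.Injective t ∧ (∀ i, ((t i : E3) ∈ S ∧ (t i : E3) ≠ 0)) ∧
        (∀ w ∈ S, w ≠ 0 → ‖w‖ ≤ (5 / 4 - θ) * a → ∃ i, (t i : E3) = w) ∧
        ∀ i, dist (t i : E3) (L (a • (if c then qf i else qh i))) ≤ a / 100 + θ := by
  obtain ⟨a, ha1, ha2, T, hT, hclose⟩ := h
  have ha0 : a ≠ 0 := by
    intro h
    rw [h] at ha1
    norm_num at ha1
  have hmemT : ∀ w : E3, w ∈ T ↔ w ∈ S ∧ w ≠ 0 ∧ ‖w‖ ≤ (5 / 4 - θ) * a := by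
    intro w
    rw [← Finset.mem_coe, hT, Set.mem_setOf_eq, count_restrict_singleton_ne_zero_iff]
  have hTF : ∀ w ∈ T, w ∈ F := by
    intro w hw
    obtain ⟨hwS, -, hwle⟩ := (hmemT w).1 hw
    refine (hF w).2 ⟨hwS, hwle.trans ?_⟩
    nlinarith
  have build : ∀ {P : Finset E3} {q : Fin 12 → E3} (c : Bool), (∀ i, (if c then qf i else qh i) = q i) →
      Function.Injective q → (∀ i, q i ∈ P) → (∀ p ∈ P, ∃ i, q i = p) →
      ShellCloseTo (a / 100 + θ) T (Finset.image (fun v : E3 => a • v) P) →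
      ∃ c : Bool, ∃ L : E3 →L[ℝ] E3, (∀ v, ‖L v‖ = ‖v‖) ∧
        ∃ t : Fin 12 → ↥F, Function.Injective t ∧ (∀ i, ((t i : E3) ∈ S ∧ (t i : E3) ≠ 0)) ∧
          (∀ w ∈ S, w ≠ 0 → ‖w‖ ≤ (5 / 4 - θ) * a → ∃ i, (t i : E3) = w) ∧
          ∀ i, dist (t i : E3) (L (a • (if c then qf i else qh i))) ≤ a / 100 + θ := by
    intro P q c hcq hq hqP hPq hc
    obtain ⟨A, t, ht, htT, hTt, hdist⟩ := exists_tuple_of_shellCloseTo hq hqP hPq ha0 hc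
    refine ⟨c, A.toContinuousLinearMap, fun v => A.norm_map v, fun i => ⟨t i, hTF _ (htT i)⟩,
      fun i j hij => ht (congrArg Subtype.val hij), fun i => ?_, fun w hwS hw0 hwle => ?_, fun i => ?_⟩
    · obtain ⟨hwS, hw0, -⟩ := (hmemT _).1 (htT i)
      exact ⟨hwS, hw0⟩
    · exact hTt w ((hmemT w).2 ⟨hwS, hw0, hwle⟩)
    · rw [hcq i]
      exact hdist i
  rcases hclose with hc | hc
  · exact ⟨a, ha1, ha2, build true (fun i => rfl) hqf hqfP hPqf hc⟩
  · exact ⟨a, ha1, ha2, build false (fun i => rfl) hqh hqhP hPqh hc⟩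

/-! ## The stub -/

/-- **Stub `stub_boundaryShell` of line `elastic-coarse-to-fine` (r5), crux `MinimiserShells` — the BOUNDARY LEMMA.**
Granted the covering property of the kissing patterns, if `S ∋ 0` is `δ`-separated (`δ > 0`), the root shell of
`count|S` is `1/(n+10)`-loosely good for every `n`, and the shell of every atom of `S` is `1/100`-loosely good, then the
root shell is good in the exact sense of the crux.  Discretise each loosened test (`exists_data_of_looseGoodShell`), fix
one matching occurring for infinitely many levels (pigeonhole), pass to a common scale and isometry
(`exists_limit_param`), and exclude a 13th atom on the sphere `‖k‖ = 5a/4` by the neighbours' shells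
(`shell_of_limit_data`, `no_sphere_atom`). -/
theorem stub_boundaryShell :
    (∀ (A : EuclideanSpace ℝ (Fin 3) →ₗᵢ[ℝ] EuclideanSpace ℝ (Fin 3)) (u : EuclideanSpace ℝ (Fin 3)),
      (∃ p ∈ fccKissingPattern, ‖u‖ ^ 2 ≤ 2 * (inner ℝ u (A p)) ^ 2 ∧ 0 ≤ inner ℝ u (A p)) ∧
      (∃ p ∈ hcpKissingPattern, ‖u‖ ^ 2 ≤ 2 * (inner ℝ u (A p)) ^ 2 ∧ 0 ≤ inner ℝ u (A p))) →
    ∀ δ : ℝ, 0 < δ → ∀ S : Set (EuclideanSpace ℝ (Fin 3)), (0 : EuclideanSpace ℝ (Fin 3)) ∈ S →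
      (∀ x ∈ S, ∀ z ∈ S, x ≠ z → δ ≤ dist x z) →
      (∀ n : ℕ, LooseGoodShell (1 / ((n : ℝ) + 10))
        ((Measure.count : Measure (EuclideanSpace ℝ (Fin 3))).restrict S)) →
      (∀ y ∈ S, LooseGoodShell (1 / 100)
        ((Measure.count : Measure (EuclideanSpace ℝ (Fin 3))).restrict ((fun z => z - y) '' S))) →
      GoodShell ((Measure.count : Measure (EuclideanSpace ℝ (Fin 3))).restrict S) := by
  intro hcov δ hδ S h0 hsep hall hnb
  -- enumerations of the two patterns
  obtain ⟨qf, hqf, hqfP, hPqf⟩ := exists_enum card_fccKissingPattern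
  obtain ⟨qh, hqh, hqhP, hPqh⟩ := exists_enum card_hcpKissingPattern
  -- the finite window of atoms of norm `≤ 5/4`
  have hfin : (S ∩ Metric.closedBall (0 : E3) (5 / 4)).Finite :=
    UniformlyDiscrete.finite_inter_closedBall ⟨δ, hδ, hsep⟩ 0 (5 / 4)
  have hF : ∀ w : E3, w ∈ hfin.toFinset ↔ w ∈ S ∧ ‖w‖ ≤ 5 / 4 := by
    intro w
    rw [Set.Finite.mem_toFinset, Set.mem_inter_iff, Metric.mem_closedBall, dist_zero_right]
  -- the levels
  have hθ0 : ∀ n : ℕ, (0 : ℝ) ≤ 1 / ((n : ℝ) + 10) := fun n => by positivity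
  -- discretised data at every level, and one matching occurring infinitely often
  choose a ha1 ha2 c L hL t ht htS hTt hdist using fun n : ℕ =>
    exists_data_of_looseGoodShell hF hqf hqfP hPqf hqh hqhP hPqh (hθ0 n) (hall n)
  obtain ⟨d, hd⟩ := Finite.exists_infinite_fiber fun n => (c n, t n)
  have hinf : ((fun n => (c n, t n)) ⁻¹' {d}).Infinite := Set.infinite_coe_iff.1 hd
  have hfib : ∀ m : ℕ, ∃ n, m ≤ n ∧ c n = d.1 ∧ t n = d.2 := by
    intro m
    obtain ⟨n, hn, hmn⟩ := hinf.exists_gt m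
    have hn' : (c n, t n) = d := hn
    exact ⟨n, hmn.le, (Prod.ext_iff.1 hn').1, (Prod.ext_iff.1 hn').2⟩
  -- a common scale and isometry for all levels
  obtain ⟨a₀, ha₀1, ha₀2, A, hdA, hout⟩ := exists_limit_param hfin.toFinset
    (fun i => if d.1 then qf i else qh i) (fun i => (d.2 i : E3)) (fun n => 1 / ((n : ℝ) + 10)) hθ0
    (fun n => one_div_le_one_div_of_le (by positivity) (by push_cast; linarith))
    (fun ε hε => by
      obtain ⟨n, hn⟩ := exists_nat_gt (1 / ε)
      refine ⟨n, ?_⟩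
      have h1 : 1 < ε * (n : ℝ) := by rwa [div_lt_iff₀ hε, mul_comm] at hn
      rw [div_lt_iff₀ (by positivity)]
      nlinarith)
    (fun m => by
      obtain ⟨n, hmn, hcn, htn⟩ := hfib m
      refine ⟨n, hmn, a n, ha1 n, ha2 n, L n, hL n, fun i => ?_, fun w hw hw0 hne => ?_⟩
      · have h := hdist n i
        rwa [htn, hcn] at h
      · by_contra hlt
        obtain ⟨i, hi⟩ := hTt n w ((hF w).1 hw).1 hw0 (le_of_lt (not_le.1 hlt))
        rw [htn] at hi
        exact hne i hi)
  -- the tuple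
  obtain ⟨n₀, -, -, htn₀⟩ := hfib 0
  have ht₀ : Function.Injective fun i => (d.2 i : E3) := by
    intro i j hij
    have h := ht n₀
    rw [htn₀] at h
    exact h (Subtype.ext hij)
  have ht₀S : ∀ i, (d.2 i : E3) ∈ S ∧ (d.2 i : E3) ≠ 0 := by
    intro i
    have h := htS n₀ i
    rwa [htn₀] at h
  have hout' : ∀ w ∈ S, w ≠ 0 → ‖w‖ ≤ 5 / 4 → (∀ i, (d.2 i : E3) ≠ w) → 5 / 4 * a₀ ≤ ‖w‖ :=
    fun w hwS hw0 hwle hne => hout w ((hF w).2 ⟨hwS, hwle⟩) hw0 hne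
  -- conclusion, by cases on the pattern
  refine ⟨a₀, ha₀1, ha₀2, ?_⟩
  obtain ⟨c₀, t₀⟩ := d
  cases c₀
  · obtain ⟨T, hT, hclose⟩ := shell_of_limit_data h0 ha₀1 ha₀2
      (fun p hp => norm_eq_one_of_mem_hcpKissingPattern hp) hqh hqhP hPqh ht₀ (fun i => (ht₀S i).1)
      (fun i => (ht₀S i).2) (by simpa using hdA) hout' hnb (fun u => (hcov A u).2)
    exact ⟨T, hT, Or.inr hclose⟩
  · obtain ⟨T, hT, hclose⟩ := shell_of_limit_data h0 ha₀1 ha₀2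
      (fun p hp => norm_eq_one_of_mem_fccKissingPattern hp) hqf hqfP hPqf ht₀ (fun i => (ht₀S i).1)
      (fun i => (ht₀S i).2) (by simpa using hdA) hout' hnb (fun u => (hcov A u).1)
    exact ⟨T, hT, Or.inl hclose⟩

end Summit.AtomisticToContinuum.Crystallization.Theorems.PalmUnimodularRigidityMinimiserShells.BoundaryShell

end
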